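/-
Copyright (c) 2026. All rights reserved.
Released under Apache 2.0 license as described in the file LICENSE.
-/
import Summits.Langlands.Langlands.Theorems.SoloInformedRepairD2CrisTeichmuller
import HarnessLib

/-!
# The residue-degree factor of `dim D_cris`: `m · f` independent `φ^f`-fixed vectors in `D_cris(𝟙_m)`

Solo/informed seat, statement repair D2-cris.  `CrystallineCompatibleAt` (file `SoloInformedRepairD2Cris`)
predicts for `ρ|Γ_{K_v}` crystalline a `ℚ̄_ℓ`-basis of `D_cris` of size `n · f(v|ℓ)` with
`charpoly (φ^{f}) = (∏_{a ∈ α} (X - ι⁻¹ a))^{f}`.  For the TRIVIAL representation `𝟙_m` (Satake parameter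
`α = {1, …, 1}`) this says: `dim D_cris(𝟙_m) = m·f` and `φ^f = 1`.  Over the CONSTRUCTED `B_max(F)` of the
tree we certify the attainable half:

* `linearIndependent_single_tmul` (linear algebra): if `u_j ∈ B` are `ℚ_p`-linearly independent then the
  pure tensors `e_i ⊗ u_j ∈ E^m ⊗_{ℚ_p} B` are `E`-linearly independent (test against `1 ⊗ g` for a
  `ℚ_p`-linear functional `g` dual to the `u_j`);
* `single_tmul_teichBmax_mem_Dcris_one`, `phiDcris_iterate_teichVector_eq_self`: the vectors
  `e_i ⊗ u_{a_j}` (Teichmüller periods `u_{a_j}`, file `SoloInformedRepairD2CrisTeichmuller`) lie in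
  `D_cris(𝟙_m) = (ℚ̄_p^m ⊗ B_max(F))^{Γ_F}` and are fixed by `φ_D^f` when `q_F = p^f`;
* `linearIndependent_teichVector`, `mul_le_finrank_Dcris_one`: they are `ℚ̄_p`-linearly independent
  (given `θ` surjective), so `m · f ≤ dim D_cris(𝟙_m)` whenever the latter is finite-dimensional;
  `exists_linearIndependent_phiDcris_iterate_eq` packages `m·f` independent `φ^f`-fixed vectors.

Not proved (needs `B_max(F)^{Γ_F} = F₀`, absent from the tree): `dim D_cris(𝟙_m) ≤ m·f`.

References: Fontaine, Astérisque 223 (1994), Exp. III §1.3–§1.5, Exp. VIII §2.3.7; Buzzard–Gee,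
*The conjectural connections between automorphic representations and Galois representations* (2014), Conj. 3.2.2.
-/

noncomputable section

open scoped MatrixGroups TensorProduct ValuativeRel
open Field WittVector ValuativeRel
open Literature.NumberTheory.GaloisRepresentations Literature.NumberTheory.PAdicHodge
open Literature.NumberTheory.GaloisRepresentations.IsNonarchimedeanLocalField

namespace Summit.Langlands.Langlands.Theorems

namespace D2Cris

/-! ### §1 Linear algebra: pure tensors `e_i ⊗ u_j` with `u_j` independent are independent -/

section Abstract

variable {p : ℕ} [Fact p.Prime] {E : Type*} [Field E] [Algebra ℚ_[p] E]
  {B : Type*} [CommRing B] [Algebra ℚ_[p] B] {m : ℕ} {ι : Type*}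

/-- A linear functional dual to one member of a linearly independent family over a field:
`g (u j) = δ_{j j₀}`. [folklore] -/
theorem exists_dual_eq_ite {K V : Type*} [Field K] [AddCommGroup V] [Module K V] [DecidableEq ι]
    {u : ι → V} (hu : LinearIndependent K u) (j₀ : ι) :
    ∃ g : V →ₗ[K] K, ∀ j, g (u j) = if j = j₀ then 1 else 0 := by
  obtain ⟨g, hg⟩ := LinearMap.exists_extend ((Module.Basis.span hu).coord j₀)
  refine ⟨g, fun j => ?_⟩
  have h := LinearMap.congr_fun hg ((Module.Basis.span hu) j)
  simp only [LinearMap.comp_apply, Submodule.subtype_apply, Module.Basis.coord_apply, Module.Basis.repr_self,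
    Finsupp.single_apply] at h
  simpa [Module.Basis.span_apply] using h

/-- The `E`-linear test map `v ⊗ b ↦ g(b) · v : E^m ⊗_{ℚ_p} B → E^m` of a `ℚ_p`-linear functional `g` on `B`.
[folklore] -/
def testMap (g : B →ₗ[ℚ_[p]] ℚ_[p]) : (Fin m → E) ⊗[ℚ_[p]] B →ₗ[E] (Fin m → E) :=
  (TensorProduct.AlgebraTensorModule.rid ℚ_[p] E (Fin m → E)).toLinearMap ∘ₗ
    TensorProduct.AlgebraTensorModule.map LinearMap.id g

/-- `testMap g (v ⊗ b) = g b • v`. [folklore] -/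
theorem testMap_tmul (g : B →ₗ[ℚ_[p]] ℚ_[p]) (v : Fin m → E) (b : B) :
    testMap g (v ⊗ₜ[ℚ_[p]] b) = g b • v := by
  simp [testMap]

/-- **`e_i ⊗ u_j` are `E`-linearly independent in `E^m ⊗_{ℚ_p} B`** when the `u_j ∈ B` are `ℚ_p`-linearly
independent (apply `testMap g` for `g` dual to `u_{j₀}`, then read off the `i₀`-th coordinate). [folklore] -/
theorem linearIndependent_single_tmul [Fintype ι] {u : ι → B} (hu : LinearIndependent ℚ_[p] u) :
    LinearIndependent E (fun ij : Fin m × ι => (Pi.single ij.1 (1 : E) : Fin m → E) ⊗ₜ[ℚ_[p]] u ij.2) := by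
  classical
  refine Fintype.linearIndependent_iff.2 fun c hc ij => ?_
  obtain ⟨i₀, j₀⟩ := ij
  obtain ⟨g, hg⟩ := exists_dual_eq_ite hu j₀
  have h := congrArg (testMap (E := E) (m := m) g) hc
  rw [map_sum, map_zero, Fintype.sum_prod_type] at h
  simp only [map_smul, testMap_tmul, hg, ite_smul, one_smul, zero_smul, smul_ite, smul_zero,
    Finset.sum_ite_eq', Finset.mem_univ, if_true] at h
  have h3 := congr_fun h i₀
  simpa [Finset.sum_apply, Pi.single_apply] using h3

end Abstract

/-! ### §2 `D_cris(𝟙_m)` over the constructed `B_max(F)` -/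

variable {F : Type} [Field F] [ValuativeRel F] [TopologicalSpace F] [IsNonarchimedeanLocalField F]
  [CharZero F] {p : ℕ} [Fact p.Prime] [Fact (¬ IsUnit (p : maxUnramifiedCompletion F))]
  [CharP (IsLocalRing.ResidueField (maxUnramifiedCompletion F)) p] [Fact (¬ IsUnit (p : integerC F))]
  [IsAdicComplete (Ideal.span {(p : integerC F)}) (integerC F)] {m : ℕ}

omit [Fact (¬ IsUnit (p : maxUnramifiedCompletion F))] [CharP (IsLocalRing.ResidueField (maxUnramifiedCompletion F)) p] in
/-- `φ_D` is `1 ⊗ φ` on underlying tensors. [folklore] -/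
theorem coe_phiDcris (ρv : FramedRep (absoluteGaloisGroup F) (PadicAlgCl p) m) (x : Dcris (F := F) (p := p) ρv) :
    ((phiDcris ρv x : Dcris ρv) : (Fin m → PadicAlgCl p) ⊗[ℚ_[p]] Bmax F p) =
      phiTensor (frobBmaxAlgHom F p) (x : (Fin m → PadicAlgCl p) ⊗[ℚ_[p]] Bmax F p) := rfl

/-- **`e_i ⊗ u_a ∈ D_cris(𝟙_m)`**: a Teichmüller period tensored with a basis vector is `Γ_F`-invariant for
the trivial representation. [cite: FontaineAsterisque223III, Exp. III §1.5] -/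
theorem single_tmul_teichBmax_mem_Dcris_one (i : Fin m) (a : 𝒪[F]) :
    ((Pi.single i 1 : Fin m → PadicAlgCl p) ⊗ₜ[ℚ_[p]] teichBmax (F := F) (p := p) a) ∈
      Dcris (F := F) (p := p) (1 : FramedRep (absoluteGaloisGroup F) (PadicAlgCl p) m) := by
  intro σ
  change TensorProduct.AlgebraTensorModule.map
      (Matrix.toLin' (((1 : FramedRep (absoluteGaloisGroup F) (PadicAlgCl p) m) σ : GL (Fin m) (PadicAlgCl p)) :
        Matrix (Fin m) (Fin m) (PadicAlgCl p)))
      (galBmaxAlgHom (F := F) (p := p) σ).toLinearMap _ = _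
  rw [show ((1 : FramedRep (absoluteGaloisGroup F) (PadicAlgCl p) m) σ : GL (Fin m) (PadicAlgCl p)) = 1 from rfl,
    Units.val_one, Matrix.toLin'_one, TensorProduct.AlgebraTensorModule.map_tmul, LinearMap.id_apply,
    AlgHom.toLinearMap_apply,
    show galBmaxAlgHom (F := F) (p := p) σ (teichBmax a) = galBmax σ (teichBmax a) from rfl, galBmax_teichBmax]

/-- **The vector `e_i ⊗ u_a ∈ D_cris(𝟙_m)`.** [cite: FontaineAsterisque223III, Exp. III §1.5] -/
def teichVector (i : Fin m) (a : 𝒪[F]) : Dcris (F := F) (p := p) (1 : FramedRep (absoluteGaloisGroup F) (PadicAlgCl p) m) :=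
  ⟨_, single_tmul_teichBmax_mem_Dcris_one i a⟩

/-- Underlying tensor of `teichVector i a`. [folklore] -/
theorem coe_teichVector (i : Fin m) (a : 𝒪[F]) :
    ((teichVector (F := F) (p := p) i a : Dcris (1 : FramedRep (absoluteGaloisGroup F) (PadicAlgCl p) m)) :
        (Fin m → PadicAlgCl p) ⊗[ℚ_[p]] Bmax F p) =
      (Pi.single i 1 : Fin m → PadicAlgCl p) ⊗ₜ[ℚ_[p]] teichBmax a := rfl

/-- **`φ_D^k (e_i ⊗ u_a) = e_i ⊗ φ^k u_a = e_i ⊗ u_a^{p^k}`.** [cite: FontaineAsterisque223III, Exp. III §1.3] -/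
theorem coe_phiDcris_iterate_teichVector (k : ℕ) (i : Fin m) (a : 𝒪[F]) :
    (((phiDcris (1 : FramedRep (absoluteGaloisGroup F) (PadicAlgCl p) m))^[k] (teichVector (F := F) (p := p) i a) :
        Dcris (1 : FramedRep (absoluteGaloisGroup F) (PadicAlgCl p) m)) : (Fin m → PadicAlgCl p) ⊗[ℚ_[p]] Bmax F p) =
      (Pi.single i 1 : Fin m → PadicAlgCl p) ⊗ₜ[ℚ_[p]] (frobBmax F p)^[k] (teichBmax a) := by
  induction k with
  | zero => rfl
  | succ k ih =>
    rw [Function.iterate_succ_apply', Function.iterate_succ_apply', coe_phiDcris, ih]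
    simp only [phiTensor, TensorProduct.AlgebraTensorModule.map_tmul, LinearMap.id_apply, AlgHom.toLinearMap_apply]
    rfl

/-- **`φ_D^f = 1` on the vectors `e_i ⊗ u_a` when `q_F = p^f`** (the predicted `charpoly φ^f = (X-1)^{mf}` for
`𝟙_m`, on these vectors). [cite: FontaineAsterisque223VIII, §2.3.7] -/
theorem phiDcris_iterate_teichVector_eq_self {f : ℕ} (hq : residueFieldCard F = p ^ f) (i : Fin m) (a : 𝒪[F]) :
    (phiDcris (1 : FramedRep (absoluteGaloisGroup F) (PadicAlgCl p) m))^[f] (teichVector (F := F) (p := p) i a) =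
      teichVector i a :=
  Subtype.ext <| by rw [coe_phiDcris_iterate_teichVector, frobBmax_iterate_teichBmax_eq_self hq, coe_teichVector]

/-- **`m · f` independent vectors in `D_cris(𝟙_m)`**: the `e_i ⊗ u_{a_j}` are `ℚ̄_p`-linearly independent when
the residues `ā_j` are `𝔽_p`-independent (and `θ` is surjective). [cite: FontaineAsterisque223III, Exp. III §1.5] -/
theorem linearIndependent_teichVector (hF : Function.Surjective (fontaineTheta (integerC F) p)) {f : ℕ}
    {a : Fin f → 𝒪[F]} (ha : ∀ n : Fin f → ℕ, (∑ j, (n j : 𝒪[F]) * a j) ∈ 𝓂[F] → ∀ j, p ∣ n j) :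
    LinearIndependent (PadicAlgCl p)
      (fun ij : Fin m × Fin f => teichVector (F := F) (p := p) (m := m) ij.1 (a ij.2)) := by
  have h := linearIndependent_single_tmul (E := PadicAlgCl p) (m := m) (linearIndependent_teichBmax hF ha)
  have e : ((Dcris (F := F) (p := p) (1 : FramedRep (absoluteGaloisGroup F) (PadicAlgCl p) m)).subtype ∘
      fun ij : Fin m × Fin f => teichVector (F := F) (p := p) (m := m) ij.1 (a ij.2)) =
      fun ij : Fin m × Fin f => (Pi.single ij.1 1 : Fin m → PadicAlgCl p) ⊗ₜ[ℚ_[p]] teichBmax (F := F) (p := p) (a ij.2) :=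
    funext fun _ => rfl
  apply LinearIndependent.of_comp (Dcris (F := F) (p := p) (1 : FramedRep (absoluteGaloisGroup F) (PadicAlgCl p) m)).subtype
  rw [e]
  exact h

/-- **`m · f(F|ℚ_p) ≤ dim_{ℚ̄_p} D_cris(𝟙_m)`** over the constructed `B_max(F)` (whenever the latter is
finite-dimensional), for `q_F = p^f` and `θ` surjective: the attainable half of the rank clause `n · f(v|ℓ)` of
`CrystallineCompatibleAt` at the trivial representation. [cite: BuzzardGeeLMS2014, Conj. 3.2.2]
[cite: FontaineAsterisque223III, Exp. III §1.5] -/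
theorem mul_le_finrank_Dcris_one (hF : Function.Surjective (fontaineTheta (integerC F) p)) {f : ℕ}
    (hq : residueFieldCard F = p ^ f)
    [Module.Finite (PadicAlgCl p) (Dcris (F := F) (p := p) (1 : FramedRep (absoluteGaloisGroup F) (PadicAlgCl p) m))] :
    m * f ≤ Module.finrank (PadicAlgCl p) (Dcris (F := F) (p := p) (1 : FramedRep (absoluteGaloisGroup F) (PadicAlgCl p) m)) := by
  obtain ⟨a, ha⟩ := exists_residue_independent (F := F) p hq
  have h := (linearIndependent_teichVector (m := m) hF ha).fintype_card_le_finrank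
  simpa [Fintype.card_prod, Fintype.card_fin] using h

/-- **Summary**: for `q_F = p^f` and `θ` surjective, `D_cris(𝟙_m)` over the constructed `B_max(F)` contains
`m · f` `ℚ̄_p`-linearly independent vectors fixed by `φ_D^f` — consistent with, and the attainable half of,
`finrank = m·f ∧ charpoly (φ^f) = (X - 1)^{m f}` predicted by `CrystallineCompatibleAt` for the trivial
representation. [cite: BuzzardGeeLMS2014, Conj. 3.2.2] [cite: FontaineAsterisque223VIII, §2.3.7] -/
theorem exists_linearIndependent_phiDcris_iterate_eq (hF : Function.Surjective (fontaineTheta (integerC F) p))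
    {f : ℕ} (hq : residueFieldCard F = p ^ f) :
    ∃ v : Fin m × Fin f → Dcris (F := F) (p := p) (1 : FramedRep (absoluteGaloisGroup F) (PadicAlgCl p) m),
      LinearIndependent (PadicAlgCl p) v ∧
        ∀ ij, (phiDcris (1 : FramedRep (absoluteGaloisGroup F) (PadicAlgCl p) m))^[f] (v ij) = v ij := by
  obtain ⟨a, ha⟩ := exists_residue_independent (F := F) p hq
  exact ⟨fun ij => teichVector ij.1 (a ij.2), linearIndependent_teichVector hF ha,
    fun ij => phiDcris_iterate_teichVector_eq_self hq ij.1 (a ij.2)⟩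

end D2Cris

end Summit.Langlands.Langlands.Theorems

end
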